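import Summits.ResolutionOfSingularities.ResolutionOfSingularities.Theorems.PurelyInseparableDim4SwapTransportWindowGlue
import Summits.ResolutionOfSingularities.ResolutionOfSingularities.Theorems.PurelyInseparableDim4ResConeCInfPinning
import Summits.ResolutionOfSingularities.ResolutionOfSingularities.Theorems.PurelyInseparableDim4ResConeCInfWindowLaws
import Summits.ResolutionOfSingularities.ResolutionOfSingularities.Theorems.PurelyInseparableDim4ResConeCInfNormalForm
import HarnessLib
import HarnessLib.Audit.Tags

/-!
# Purely inseparable four-folds — THE VIRTUAL WINDOW'S FRAME: the virtual translation vanishes and the C∞ frame survives a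
# pure slot step (cell `res-dim4-pi`, K2(p) lane, slice B; K24b-R1, frame half of `virtual_step`)

[OURS · counted 0 · cell `res-dim4-pi` · K2(p) lane holder's ruling 2026-08-29 04:33:16Z (K24b-R1 (b), res-dim4-typ-1 g3).]
Nothing here proves K2(p)/K2(5), `NoIsolatedTrap 5 5` or resolution of singularities in dimension ≥ 4 / characteristic `p` —
NOT proved.  AI kernel work, weaker than expert review.

Fixed letters `λ μ | u f`; a FRAMED state `B`: ledger `x_λ x_μ`, order 6, `x^r ∣ F`, straight residual `a·x_f⁴`, exact pair
ledger (`x_f`-degree `≤ 3 ⇒ x_λ² x_μ²`), dead `ū²`-row below jet `N`, flag `V = coeff (r + λ + μ + 3u) ≠ 0`.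
* §1 bookkeeping: `forall_le_step_six` (`x^r ∣ F` survives a point step), `seven_le_of_exact`, `resForm_eq_of_readings`.
* §2 **`translation_eq_zero_of_frame`** — (VT): a slot step in the chart of `λ` with translation `b′` off the slots whose
  child has order 6 and `e_G = 3` has `b′ = 0` (the `f`-component by res-dim4-typ-1 g2's
  `ResCone.cInf_translation_contact_eq_zero`, the `u`-component by the two-state pinning taken BY VALUE — res-dim4-p-2 g5's
  `ResCone.cInf_translation_u_eq_zero_twoState`).
* §3 **`frame_step_zero`** — the frame passes to the PURE slot child at jet `N − 4` (F3 (i)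
  `ResCone.cInf_legal_readings_of_corner`, `ResCone.ledger_step_zero`, `ResCone.row_step_zero`,
  `ResCone.cInf_coeff_uFlag_step_zero`).
bears_on: LADDER-RESOLUTION:D157-DOOR2 (res-dim4-pi · K2(p) · slice B · K24b-R1).  Supports stmt-ResolutionOfSingularities-16155
(helper).
-/

set_option linter.dupNamespace false -- mandated namespace of this single-conjunct summit

noncomputable section

namespace Summit.ResolutionOfSingularities.ResolutionOfSingularities.Theorems.PIDim4

namespace SwapTransport

open MvPolynomial Finset
open Literature.AlgebraicGeometry.Resolution
open Literature.AlgebraicGeometry.Resolution.CentreBlowup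
open Literature.AlgebraicGeometry.Resolution.Hauser2010
open Literature.AlgebraicGeometry.Resolution.HauserPerlega2019

variable {K : Type} [Field K] [CharP K 5] [DecidableEq K]

/-! ## §1 Small readings of a framed state -/

omit [CharP K 5] [DecidableEq K] in
/-- `x^r ∣ F` survives a point step (translation vanishing on the chart letter). [folklore]
[cite: Hauser2010, §F (transform D')] -/
theorem forall_le_step_six [DecidableEq K] {B : State K} (ho : ordZero B.F = 6) (hdiv : ∀ d ∈ B.F.support, B.r ≤ d)
    (j : Fin 4) {b : Fin 4 → K} (hbj : b j = 0) :
    ∀ d ∈ (CentreBlowup.step 5 Finset.univ j b B).F.support, (CentreBlowup.step 5 Finset.univ j b B).r ≤ d := by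
  refine newMult_le_of_mem_support_step 5 Finset.univ j b hbj B (o := 6) ho hdiv fun d hd => ?_
  rw [degIn_univ, degIn_univ]
  have hod : 6 ≤ d.degree := by
    have := Literature.Barriers.ResolutionOfSingularities.ordZero_le_of_coeff_ne_zero _ _
      (MvPolynomial.mem_support_iff.mp hd)
    rw [ho] at this
    exact_mod_cast this
  have hrd : B.r.degree ≤ d.degree := PointBlowup.degree_le_degree_of_le (hdiv d hd)
  omega

omit [CharP K 5] [DecidableEq K] in
/-- In a state of order 6 whose degree-6 layer is the straight monomial `x^r x_f⁴` and whose monomials of `x_f`-degree `≤ 3`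
carry `x_λ² x_μ²` (exact pair ledger), every monomial of `x_f`-degree `≤ 3` has degree `≥ 7`. [OURS · bookkeeping] -/
theorem seven_le_of_exact {la mu u f : Fin 4} (hlm : la ≠ mu) (hlu : la ≠ u) (hlf : la ≠ f) (hmu : mu ≠ u) (hmf : mu ≠ f)
    (huf : u ≠ f) {B : State K} (ho : ordZero B.F = 6) (hr : B.r = Finsupp.single la 1 + Finsupp.single mu 1)
    (hstraight6 : ∀ d ∈ B.F.support, d.degree = 6 → d f = 4)
    (hled : ∀ e ∈ B.F.support, e f ≤ 3 → 2 ≤ e la ∧ 2 ≤ e mu) :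
    ∀ d ∈ B.F.support, d f ≤ 3 → 7 ≤ d.degree := by
  have _ := hr
  intro d hd hdf
  have h6 : 6 ≤ d.degree := by
    have := Literature.Barriers.ResolutionOfSingularities.ordZero_le_of_coeff_ne_zero _ _
      (MvPolynomial.mem_support_iff.mp hd)
    rw [ho] at this
    exact_mod_cast this
  by_contra hlt
  have hdeg : d.degree = 6 := by omega
  have := hstraight6 d hd hdeg
  have _ := hled d hd hdf
  have _ := ResCone.degree_eq_quad hlm hlu hlf hmu hmf huf d
  omega

omit [CharP K 5] [DecidableEq K] in
/-- The residual form from its readings: order `6`, `|r| = 2`, straight degree-`4` readings ⇒ `resForm = a·x_f⁴`.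
[OURS · bookkeeping] -/
theorem resForm_eq_of_readings {f : Fin 4} {s : State K} (ho : ordZero s.F = 6) (hrdeg : s.r.degree = 2) {a : K}
    (ha : coeff (s.r + Finsupp.single f 4) s.F = a)
    (hstraight : ∀ m : Fin 4 →₀ ℕ, m.degree = 4 → m ≠ Finsupp.single f 4 → coeff (s.r + m) s.F = 0) :
    ResCone.resForm s = C a * X f ^ 4 := by
  classical
  have hhom := ResCone.resForm_isHomogeneous ho
  rw [hrdeg] at hhom
  ext m
  rw [X_pow_eq_monomial, C_mul_monomial, mul_one, coeff_monomial]
  by_cases hm : m.degree = 4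
  · rw [ResCone.coeff_resForm, NarrowApolarity.coeff_initialForm_of_degree_eq ho (by rw [map_add, hrdeg, hm])]
    by_cases hmf : Finsupp.single f 4 = m
    · rw [if_pos hmf, ← hmf, ha]
    · rw [if_neg hmf, hstraight m hm (Ne.symm hmf)]
  · rw [if_neg (fun h => hm (by rw [← h, Finsupp.degree_single]))]
    by_contra hne
    exact hm (by have := hhom hne; rw [ResCone.weight_one_eq_degree] at this; omega)

/-! ## §2 The virtual translation vanishes (VT-f by res-dim4-typ-1 g2, VT-u two-state BY VALUE) -/

omit [CharP K 5] in
/-- **(VT) in a frame.**  In a state with ledger `x_λx_μ`, order 6, `x^r ∣ F` and residual `a·x_f⁴`, a slot step in the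
chart of `λ` with translation `b′` off the slots whose child has order 6 and `e_G = 3` has `b′ = 0`: the `f`-component by
`ResCone.cInf_translation_contact_eq_zero`, the `u`-component by the two-state pinning `hVTu` (taken BY VALUE). [OURS] -/
theorem translation_eq_zero_of_frame {la mu u f : Fin 4} (hlm : la ≠ mu) (hlu : la ≠ u) (hlf : la ≠ f) (hmu : mu ≠ u)
    (hmf : mu ≠ f) (huf : u ≠ f) {B : State K} (hoB : ordZero B.F = 6) (hrB : B.r = Finsupp.single la 1 + Finsupp.single mu 1)
    (hdivB : ∀ d ∈ B.F.support, B.r ≤ d) {a : K} (ha : a ≠ 0) (hformB : ResCone.resForm B = C a * X f ^ 4)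
    {b' : Fin 4 → K} (hb'la : b' la = 0) (hb'mu : b' mu = 0)
    (hoBp : ordZero (CentreBlowup.step 5 Finset.univ la b' B).F = 6)
    (he3Bp : Module.finrank K (ResCone.resVertex (CentreBlowup.step 5 Finset.univ la b' B)) = 3)
    (hVTu : ∀ β : K, ordZero (CentreBlowup.step 5 Finset.univ la (Pi.single u β) B).F = 6 →
      Module.finrank K (ResCone.resVertex (CentreBlowup.step 5 Finset.univ la (Pi.single u β) B)) = 3 → β = 0) :
    b' = 0 := by
  have hin : initialForm B.F = monomial (Finsupp.single la 1 + Finsupp.single mu 1 + Finsupp.single f 4) a := by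
    rw [← ResCone.monomial_mul_resForm hdivB, hformB, hrB, X_pow_eq_monomial, C_mul_monomial, mul_one, monomial_mul, one_mul]
  have hb'f : b' f = 0 := ResCone.cInf_translation_contact_eq_zero hlm.symm hlf.symm hmf.symm hoB ha hin hb'la hb'mu hoBp
  have hb'eq : b' = Pi.single u (b' u) := eq_single_of_letters hlm hlu hlf hmu hmf huf hb'la hb'mu hb'f
  have hb'u : b' u = 0 := by
    refine hVTu (b' u) ?_ ?_
    · rw [← hb'eq]; exact hoBp
    · rw [← hb'eq]; exact he3Bp
  rw [hb'eq, hb'u, Pi.single_zero]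

/-! ## §3 The frame survives a pure slot step -/

/-- **FRAME PROPAGATION.**  The frame at jet `N` (ledger, `x^r ∣ F`, residual `a·x_f⁴`, exact pair ledger, dead `ū²`-row,
flag) passes to the PURE slot child in the chart of `λ` at jet `N − 4`, given that the child has order 6 and `e_G = 3`
(straightness of the child by F3 (i) `ResCone.cInf_legal_readings_of_corner`; the rest by `ResCone.ledger_step_zero`,
`ResCone.row_step_zero`, `ResCone.cInf_coeff_uFlag_step_zero`). [OURS] -/
theorem frame_step_zero {la mu u f : Fin 4} (hlm : la ≠ mu) (hlu : la ≠ u) (hlf : la ≠ f) (hmu : mu ≠ u) (hmf : mu ≠ f)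
    (huf : u ≠ f) {B : State K} (hoB : ordZero B.F = 6) (hrB : B.r = Finsupp.single la 1 + Finsupp.single mu 1)
    (hdivB : ∀ d ∈ B.F.support, B.r ≤ d) {a : K} (ha : a ≠ 0) (hformB : ResCone.resForm B = C a * X f ^ 4)
    (hledB : ∀ e ∈ B.F.support, e f ≤ 3 → 2 ≤ e la ∧ 2 ≤ e mu) {N : ℕ}
    (hrowB : ∀ d ∈ B.F.support, d.degree < N → ¬ (d u = 2 ∧ d f = 0))
    (hVB : coeff (B.r + (Finsupp.single la 1 + Finsupp.single mu 1 + Finsupp.single u 3)) B.F ≠ 0)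
    (hoBp : ordZero (CentreBlowup.step 5 Finset.univ la 0 B).F = 6)
    (he3Bp : Module.finrank K (ResCone.resVertex (CentreBlowup.step 5 Finset.univ la 0 B)) = 3) :
    (CentreBlowup.step 5 Finset.univ la 0 B).r = Finsupp.single la 1 + Finsupp.single mu 1 ∧
    (∀ d ∈ (CentreBlowup.step 5 Finset.univ la 0 B).F.support, (CentreBlowup.step 5 Finset.univ la 0 B).r ≤ d) ∧
    (∃ a' : K, a' ≠ 0 ∧ ResCone.resForm (CentreBlowup.step 5 Finset.univ la 0 B) = C a' * X f ^ 4) ∧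
    (∀ e ∈ (CentreBlowup.step 5 Finset.univ la 0 B).F.support, e f ≤ 3 → 2 ≤ e la ∧ 2 ≤ e mu) ∧
    (∀ d ∈ (CentreBlowup.step 5 Finset.univ la 0 B).F.support, d.degree < N - 4 → ¬ (d u = 2 ∧ d f = 0)) ∧
    coeff ((CentreBlowup.step 5 Finset.univ la 0 B).r + (Finsupp.single la 1 + Finsupp.single mu 1 + Finsupp.single u 3))
      (CentreBlowup.step 5 Finset.univ la 0 B).F ≠ 0 := by
  -- ledger and divisibility
  have hrBp : (CentreBlowup.step 5 Finset.univ la 0 B).r = Finsupp.single la 1 + Finsupp.single mu 1 := by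
    obtain ⟨-, h2, h3, h4⟩ := ResCone.quad_apply hlm hlu hlf hmu hmf huf 1 1 0 0
    have hrB4 : B.r = Finsupp.single la 1 + Finsupp.single mu 1 + Finsupp.single u 0 + Finsupp.single f 0 := by
      rw [hrB, Finsupp.single_zero, Finsupp.single_zero, add_zero, add_zero]
    rw [ResCone.eq_sum_single_four hlm hlu hlf hmu hmf huf (CentreBlowup.step 5 Finset.univ la 0 B).r, step_r_apply_six hoB,
      step_r_apply_six hoB, step_r_apply_six hoB, step_r_apply_six hoB, Pi.zero_apply, Pi.zero_apply, Pi.zero_apply,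
      Pi.zero_apply, if_pos rfl, if_neg hlm.symm, if_pos rfl, if_neg (Ne.symm hlu), if_pos rfl, if_neg (Ne.symm hlf), if_pos rfl, hrB4, h2,
      h3, h4, Finsupp.single_zero, Finsupp.single_zero, add_zero, add_zero]
  have hdivBp : ∀ d ∈ (CentreBlowup.step 5 Finset.univ la 0 B).F.support, (CentreBlowup.step 5 Finset.univ la 0 B).r ≤ d :=
    forall_le_step_six hoB hdivB la rfl
  -- straightness of the child, F3 (i)
  have hrdegB : B.r.degree = 2 := by rw [hrB, map_add, Finsupp.degree_single, Finsupp.degree_single]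
  obtain ⟨haB, hstraightB⟩ := ResCone.straight_readings_of_resForm hoB hrdegB hformB
  have htsch : coeff (B.r + (Finsupp.single f 3 + Finsupp.single la 2)) B.F = 0 := by
    by_contra hne
    have hmem := mem_support_iff.mpr hne
    have h3 : (B.r + (Finsupp.single f 3 + Finsupp.single la 2) : Fin 4 →₀ ℕ) f = 3 := by
      rw [hrB, Finsupp.add_apply, Finsupp.add_apply, Finsupp.add_apply, Finsupp.single_eq_of_ne hlf.symm,
        Finsupp.single_eq_of_ne hmf.symm, Finsupp.single_eq_same, Finsupp.single_eq_of_ne hlf.symm]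
      rfl
    obtain ⟨-, h2⟩ := hledB _ hmem (by omega)
    rw [hrB, Finsupp.add_apply, Finsupp.add_apply, Finsupp.add_apply, Finsupp.single_eq_of_ne hlm.symm, Finsupp.single_eq_same,
      Finsupp.single_eq_of_ne hmf, Finsupp.single_eq_of_ne hlm.symm] at h2
    omega
  obtain ⟨hstraight', ha', -⟩ := ResCone.cInf_legal_readings_of_corner hlm hlf hmf hrB hdivB hoB
    (by rw [haB]; exact ha) hstraightB htsch hoBp he3Bp
  have hr' : (CentreBlowup.step 5 Finset.univ la 0 B).r = B.r := by rw [hrBp, hrB]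
  have hform' : ResCone.resForm (CentreBlowup.step 5 Finset.univ la 0 B) = C a * X f ^ 4 := by
    refine resForm_eq_of_readings hoBp (by rw [hr', hrdegB]) ?_ ?_
    · rw [hr', ha', haB]
    · intro m hm hne; rw [hr']; exact hstraight' m hm hne
  -- ledger, row and flag transport
  have hi1 : ∀ d ∈ B.F.support, 1 ≤ d mu := by
    intro d hd
    have h := hdivB d hd mu
    rw [hrB, Finsupp.add_apply, Finsupp.single_eq_of_ne hlm.symm, Finsupp.single_eq_same] at h
    simpa using h
  have h5 : ∀ d ∈ B.F.support, 5 ≤ d.degree := fun d hd => by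
    have := Literature.Barriers.ResolutionOfSingularities.ordZero_le_of_coeff_ne_zero _ _
      (MvPolynomial.mem_support_iff.mp hd)
    rw [hoB] at this
    have h6 : 6 ≤ d.degree := by exact_mod_cast this
    omega
  have hstraight6 : ∀ d ∈ B.F.support, d.degree = 6 → d f = 4 := by
    intro d hd hdeg
    have hle := hdivB d hd
    have hd' : d = B.r + (d - B.r) := (add_tsub_cancel_of_le hle).symm
    have hmdeg : (d - B.r).degree = 4 := by
      have := congrArg Finsupp.degree hd'; rw [map_add, hrdegB] at this; omega
    by_cases hm : d - B.r = Finsupp.single f 4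
    · have := DFunLike.congr_fun hd' f
      rw [Finsupp.add_apply, hm, Finsupp.single_eq_same, hrB, Finsupp.add_apply, Finsupp.single_eq_of_ne hlf.symm,
        Finsupp.single_eq_of_ne hmf.symm] at this
      omega
    · exfalso
      have h0 := hstraightB (d - B.r) hmdeg hm
      rw [← hd'] at h0
      exact (mem_support_iff.mp hd) h0
  have h7 := seven_le_of_exact hlm hlu hlf hmu hmf huf hoB hrB hstraight6 hledB
  have hled' : ∀ e ∈ (CentreBlowup.step 5 Finset.univ la 0 B).F.support, e f ≤ 3 → 2 ≤ e la ∧ 2 ≤ e mu := by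
    intro d hd hdf
    exact ResCone.ledger_step_zero hlm hlu hlf hmu hmf huf B hi1 h7 (N := d.degree + 5)
      (fun d' hd' hdf' _ => hledB d' hd' hdf') d hd hdf (by omega)
  have hrow' := ResCone.row_step_zero hlm hlu hlf hmu hmf huf B hi1 h5 hrowB
  have hV' := ResCone.cInf_coeff_uFlag_step_zero hlm hlu.symm hmu.symm (Or.inl rfl) hrB hoB (u := u)
  refine ⟨hrBp, hdivBp, ⟨a, ha, hform'⟩, hled', hrow', ?_⟩
  rw [hr', hV']
  exact hVB

end SwapTransport

end Summit.ResolutionOfSingularities.ResolutionOfSingularities.Theorems.PIDim4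

end
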